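import Summits.CriticalPhenomena.PercolationContinuityZ3.Theorems.Transplant.FKDoubleFanTransfer
import Summits.CriticalPhenomena.PercolationContinuityZ3.Theorems.Transplant.FKThreeApexPinnedNC
import HarnessLib

/-!
# Double fans `K₂ ∨ P_{m+1}`: the CUT FORMULA (reversed suffix) and the first negative correlations

Support file (`--supports stmt-CriticalPhenomena-4575`), FK sub-lane `prim-bschramm-fk-3` (gen 20); builds on p205010 (kernel theorem, internal
audit signed; external expert review pending).  No named facts, no sorries; standard axioms.  Memo `bschramm/prim-bschramm-fk-3/DOUBLE-FAN.md` §8.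
Layer 3 of the double-fan bridge.  (1) The rim step is SELF-ADJOINT for the gluing pairing: `val(s ∗ E_r X) = val(E_r s ∗ X)`
(`val_conv_rimStep`); hence the part of the word after block `j` acts on `val` as multiplication by the REVERSED-SUFFIX vector `restVec j d`
(`val_restFun`), which lies in the rim-step closure `InKE q` (`inKE_restVec`) — the CUT FORMULA `Z_w = val(restVec_j ∗ Z_j)`
(`transferDF_eq_cut`).  (2) Consequently the two spokes `a c_j`, `b c_j` at ANY rim vertex of a weighted double fan are a same-block pair of the
three-apex calculus with rest `restVec_j ∗ (input of block j) ∈ InKE q`, and the master inequality of `…ThreeApexRimStep` (`InKE.valid`) gives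
**`negCorr_spokes_at_rim`**: `φ_{w,q}(J_{a c_j} ∩ J_{b c_j}) ≤ φ_{w,q}(J_{a c_j}) φ_{w,q}(J_{b c_j})` for every `0 < q ≤ 1`, every `j ≤ m` and every
weight vector supported on the double fan — the first measure-level negative correlation on double fans `K₂ ∨ P_{m+1}` (treewidth 3, not in the
two-sum / three-apex / prism stock).
[cite: Grimmett2006, §3.9 eq. (3.94) (pp. 63–64); §1.4 eq. (1.20) (p. 15)] [folklore]
-/

noncomputable section

namespace Summit.CriticalPhenomena.PercolationContinuityZ3.Theorems

namespace FK

namespace ThreeApex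

open MeasureTheory Literature.Probability.LatticeModels Literature.Probability.Percolation
open scoped Classical

/-! ### Self-adjointness of the rim step and the same-block Rayleigh identity -/

/-- **The rim step is self-adjoint for the gluing pairing**: `val(s ∗ E_r X) = val(E_r s ∗ X)` (both are the partition function of the two
gadgets glued along `{a, b}` only, the two rim vertices joined by the rim edge). [folklore] -/
theorem val_conv_rimStep (q r : ℝ) (s X : V5) : val q (conv s (rimStep q r X)) = val q (conv (rimStep q r s) X) := by
  simp only [val, conv, rimStep, V5.total]; ring

/-- **Same-block Rayleigh identity** for the two spokes `a c`, `b c` against a rest `R`: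
`Z¹⁰Z⁰¹ − Z¹¹Z⁰⁰ = q²(1−q)·N^{(ab)}(R)`. [folklore] -/
theorem rayleigh_AC_BC_eq (q : ℝ) (R : V5) :
    val q (conv (edgeAC 1) (conv (edgeBC 0) R)) * val q (conv (edgeAC 0) (conv (edgeBC 1) R)) -
        val q (conv (edgeAC 1) (conv (edgeBC 1) R)) * val q (conv (edgeAC 0) (conv (edgeBC 0) R)) =
      q ^ 2 * (1 - q) * masterN q (swapBC R) := by
  simp only [val, conv, edgeAC, edgeBC, masterN, swapBC, V5.total]; ring

variable {V : Type*} [Fintype V]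

/-! ### The reversed suffix -/

/-- The input of block `j`: `edgeAB(w_{ab}) · δ_0` for `j = 0`, `E_{w_{c_{j-1} c_j}} Z_{j-1}` for `j ≥ 1`. [folklore] -/
def blockIn (q : ℝ) (w : Sym2 V → unitInterval) (a b : V) (c : ℕ → V) : ℕ → V5
  | 0 => conv (edgeAB (wR w s(a, b))) delta0
  | j + 1 => rimStep q (wR w s(c j, c (j + 1))) (zDF q w a b c j)

omit [Fintype V] in
/-- Block `j` of the word = its two spokes applied to its input. [folklore] -/
theorem zDF_eq_block (q : ℝ) (w : Sym2 V → unitInterval) (a b : V) (c : ℕ → V) (j : ℕ) :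
    zDF q w a b c j = conv (edgeAC (wR w s(a, c j))) (conv (edgeBC (wR w s(b, c j))) (blockIn q w a b c j)) := by
  cases j <;> rfl

/-- The blocks `j+1, …, j+d` applied to an input vector `X`. [folklore] -/
def restFun (q : ℝ) (w : Sym2 V → unitInterval) (a b : V) (c : ℕ → V) : ℕ → ℕ → V5 → V5
  | _, 0, X => X
  | j, d + 1, X => restFun q w a b c (j + 1) d
      (conv (edgeAC (wR w s(a, c (j + 1)))) (conv (edgeBC (wR w s(b, c (j + 1)))) (rimStep q (wR w s(c j, c (j + 1))) X)))

/-- **The reversed suffix vector**: the blocks `j+1, …, j+d` read backwards from `δ_0`. [folklore] -/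
def restVec (q : ℝ) (w : Sym2 V → unitInterval) (a b : V) (c : ℕ → V) : ℕ → ℕ → V5
  | _, 0 => delta0
  | j, d + 1 => rimStep q (wR w s(c j, c (j + 1)))
      (conv (restVec q w a b c (j + 1) d) (conv (edgeAC (wR w s(a, c (j + 1)))) (edgeBC (wR w s(b, c (j + 1))))))

omit [Fintype V] in
/-- The word splits at block `j`: `Z_{j+d} = restFun j d (Z_j)`. [folklore] -/
theorem zDF_add (q : ℝ) (w : Sym2 V → unitInterval) (a b : V) (c : ℕ → V) : ∀ d j, zDF q w a b c (j + d) = restFun q w a b c j d (zDF q w a b c j) := by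
  intro d
  induction d with
  | zero => intro j; rfl
  | succ d ih =>
    intro j
    rw [show j + (d + 1) = (j + 1) + d by omega, ih (j + 1)]
    rfl

omit [Fintype V] in
/-- **The suffix acts as multiplication by the reversed suffix**: `val(restFun j d X) = val(restVec j d ∗ X)`. [folklore] -/
theorem val_restFun (q : ℝ) (w : Sym2 V → unitInterval) (a b : V) (c : ℕ → V) :
    ∀ d j X, val q (restFun q w a b c j d X) = val q (conv (restVec q w a b c j d) X) := by
  intro d
  induction d with
  | zero =>
    intro j X
    show val q X = val q (conv delta0 X)
    rw [← mul_def, ← one_def, one_mul]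
  | succ d ih =>
    intro j X
    show val q (restFun q w a b c (j + 1) d _) = val q (conv (rimStep q _ (conv (restVec q w a b c (j + 1) d) _)) X)
    rw [ih, ← val_conv_rimStep]
    congr 1
    simp only [← mul_def]
    simp only [mul_assoc]

omit [Fintype V] in
/-- The reversed suffix lies in the rim-step closure of the three-apex monoid. [folklore] -/
theorem inKE_restVec (q : ℝ) (w : Sym2 V → unitInterval) (a b : V) (c : ℕ → V) : ∀ d j, InKE q (restVec q w a b c j d) := by
  intro d
  induction d with
  | zero => intro j; exact InKE.base
  | succ d ih =>
    intro j
    exact InKE.rim (w _).2.1 (w _).2.2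
      (InKE.mul (ih (j + 1)) (InKE.step (IsLetter.ac (w _).2.1 (w _).2.2) (by
        rw [← mul_one (edgeBC (wR w s(b, c (j + 1)))), mul_def, one_def]
        exact InKE.step (IsLetter.bc (w _).2.1 (w _).2.2) InKE.base)))

omit [Fintype V] in
/-- Every prefix of the word lies in the rim-step closure. [folklore] -/
theorem inKE_zDF (q : ℝ) (w : Sym2 V → unitInterval) (a b : V) (c : ℕ → V) : ∀ j, InKE q (zDF q w a b c j) := by
  intro j
  induction j with
  | zero =>
    exact InKE.step (IsLetter.ac (w _).2.1 (w _).2.2) (InKE.step (IsLetter.bc (w _).2.1 (w _).2.2)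
      (InKE.step (IsLetter.ab (w _).2.1 (w _).2.2) InKE.base))
  | succ j ih =>
    exact InKE.step (IsLetter.ac (w _).2.1 (w _).2.2) (InKE.step (IsLetter.bc (w _).2.1 (w _).2.2) (InKE.rim (w _).2.1 (w _).2.2 ih))

omit [Fintype V] in
/-- The input of every block lies in the rim-step closure. [folklore] -/
theorem inKE_blockIn (q : ℝ) (w : Sym2 V → unitInterval) (a b : V) (c : ℕ → V) (j : ℕ) : InKE q (blockIn q w a b c j) := by
  cases j with
  | zero => exact InKE.step (IsLetter.ab (w _).2.1 (w _).2.2) InKE.base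
  | succ j => exact InKE.rim (w _).2.1 (w _).2.2 (inKE_zDF q w a b c j)

omit [Fintype V] in
/-- **CUT FORMULA**: `transferDF = val(restVec_j ∗ Z_j)` for every `j ≤ m`. [folklore] -/
theorem transferDF_eq_cut (q : ℝ) (w : Sym2 V → unitInterval) (a b : V) (c : ℕ → V) {j m : ℕ} (hj : j ≤ m) :
    transferDF q w a b c m = val q (conv (restVec q w a b c j (m - j)) (zDF q w a b c j)) := by
  rw [transferDF, show m = j + (m - j) by omega, zDF_add, val_restFun, show j + (m - j) - j = m - j by omega]

/-! ### Pinning the two spokes of one rim vertex -/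

section Setting

variable {a b : V} {c : ℕ → V} {m : ℕ}
variable (hab : a ≠ b) (hinj : ∀ j k, j ≤ m → k ≤ m → c j = c k → j = k) (hca : ∀ j, j ≤ m → c j ≠ a) (hcb : ∀ j, j ≤ m → c j ≠ b)
include hab hinj hca hcb

omit [Fintype V] hab hinj hca hcb in
/-- The reversed suffix after block `j` does not read the spokes of `c j`. [folklore] -/
theorem restVec_update_eq (q : ℝ) (w : Sym2 V → unitInterval) {e : Sym2 V} (t : unitInterval) :
    ∀ d j, j + d ≤ m → (∀ k, j < k → k ≤ m → ¬ ReadsAt a b c k e) →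
      restVec q (Function.update w e t) a b c j d = restVec q w a b c j d := by
  intro d
  induction d with
  | zero => intro j _ _; rfl
  | succ d ih =>
    intro j hjd hlater
    have hr := hlater (j + 1) (by omega) (by omega)
    have h1 : e ≠ s(a, c (j + 1)) := fun h' => hr (Or.inl h')
    have h2 : e ≠ s(b, c (j + 1)) := fun h' => hr (Or.inr (Or.inl h'))
    have h4 : e ≠ s(c j, c (j + 1)) := fun h' => hr (Or.inr (Or.inr (Or.inr ⟨j, rfl, h'⟩)))
    simp only [restVec, wR_update_of_ne w (Ne.symm h1), wR_update_of_ne w (Ne.symm h2), wR_update_of_ne w (Ne.symm h4),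
      ih (j + 1) (by omega) (fun k hk hkm => hlater k (by omega) hkm)]

omit [Fintype V] hab hinj hca hcb in
/-- The input of block `j` does not read the spokes of `c j`. [folklore] -/
theorem blockIn_update_eq (q : ℝ) (w : Sym2 V → unitInterval) {e : Sym2 V} (t : unitInterval) {j : ℕ}
    (hbefore : ∀ k, k < j → ¬ ReadsAt a b c k e) (hax : e ≠ s(a, b)) (hrim : ∀ i, j = i + 1 → e ≠ s(c i, c (i + 1))) :
    blockIn q (Function.update w e t) a b c j = blockIn q w a b c j := by
  cases j with
  | zero => simp only [blockIn, wR_update_of_ne w (Ne.symm hax)]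
  | succ i =>
    simp only [blockIn, wR_update_of_ne w (Ne.symm (hrim i rfl)),
      zDF_update_eq_of_not_reads q w t i (fun k hk => hbefore k (by omega))]

omit [Fintype V] in
/-- **The word with the two spokes of `c j` pinned**: `Z_j = edgeAC(σ) · edgeBC(τ) · (input of block j)`, with the input and the reversed
suffix those of `w` itself. [folklore] -/
theorem cut_pin_spokes (q : ℝ) (w : Sym2 V → unitInterval) {j : ℕ} (hj : j ≤ m) (σ τ : unitInterval) :
    transferDF q (Function.update (Function.update w s(a, c j) σ) s(b, c j) τ) a b c m =
      val q (conv (edgeAC (σ : ℝ)) (conv (edgeBC (τ : ℝ)) (conv (restVec q w a b c j (m - j)) (blockIn q w a b c j)))) := by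
  set w₁ := Function.update w s(a, c j) σ with hw₁
  set w₂ := Function.update w₁ s(b, c j) τ with hw₂
  have hlaterA : ∀ k, j < k → k ≤ m → ¬ ReadsAt a b c k s(a, c j) := fun k hk hkm hr =>
    absurd ((readsAt_spokeA_iff hab hinj hca hcb hj hkm).1 hr) (by omega)
  have hlaterB : ∀ k, j < k → k ≤ m → ¬ ReadsAt a b c k s(b, c j) := fun k hk hkm hr =>
    absurd ((readsAt_spokeB_iff hab hinj hca hcb hj hkm).1 hr) (by omega)
  have hrest : restVec q w₂ a b c j (m - j) = restVec q w a b c j (m - j) := by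
    rw [hw₂, restVec_update_eq q w₁ τ (m - j) j (by omega) hlaterB, hw₁,
      restVec_update_eq q w σ (m - j) j (by omega) hlaterA]
  have hin : blockIn q w₂ a b c j = blockIn q w a b c j := by
    rw [hw₂, blockIn_update_eq q w₁ τ (fun k hk hr => absurd ((readsAt_spokeB_iff hab hinj hca hcb hj (by omega)).1 hr) (by omega))
      (spokeB_ne_axis hab hca hj) (fun i hi => hi ▸ spokeB_ne_rim hcb (j := i + 1) (hi ▸ hj)),
      hw₁, blockIn_update_eq q w σ (fun k hk hr => absurd ((readsAt_spokeA_iff hab hinj hca hcb hj (by omega)).1 hr) (by omega))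
      (spokeA_ne_axis hab hcb hj) (fun i hi => hi ▸ spokeA_ne_rim hca (j := i + 1) (hi ▸ hj))]
  have hσ : wR w₂ s(a, c j) = (σ : ℝ) := by
    rw [hw₂, wR_update_of_ne w₁ (spokeA_ne_spokeB hab hca hj), hw₁, wR_update_self]
  have hτ : wR w₂ s(b, c j) = (τ : ℝ) := by rw [hw₂, wR_update_self]
  rw [transferDF_eq_cut q w₂ a b c hj, zDF_eq_block, hrest, hin, hσ, hτ]
  -- commute the rest past the two spokes
  simp only [← mul_def]
  rw [mul_left_comm (restVec q w a b c j (m - j)) (edgeAC _), mul_left_comm (restVec q w a b c j (m - j)) (edgeBC _)]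

/-- **NEGATIVE CORRELATION OF THE TWO SPOKES AT ANY RIM VERTEX OF A DOUBLE FAN** (`0 < q ≤ 1`): for every weight vector supported on the
double fan `K₂ ∨ P_{m+1}` (apices `a, b`, rim `c 0 … c m`, `card V = m + 3`) and every `j ≤ m`,
`φ_{w,q}(J_{a c_j} ∩ J_{b c_j}) ≤ φ_{w,q}(J_{a c_j})·φ_{w,q}(J_{b c_j})`. [cite: Grimmett2006, §3.9 eq. (3.94) (pp. 63–64)] -/
theorem negCorr_spokes_at_rim (hcard : Fintype.card V = m + 3) {q : ℝ} (hq0 : 0 < q) (hq1 : q ≤ 1) (w : Sym2 V → unitInterval)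
    (hsupp : ∀ e, e ∉ dfPairs a b c m → w e = 0) {j : ℕ} (hj : j ≤ m) :
    (rcMeasureW w q ∅).real ({ω : BondConfig V | s(a, c j) ∈ ω} ∩ {ω | s(b, c j) ∈ ω}) ≤
      (rcMeasureW w q ∅).real {ω : BondConfig V | s(a, c j) ∈ ω} * (rcMeasureW w q ∅).real {ω : BondConfig V | s(b, c j) ∈ ω} := by
  have heA : s(a, c j) ∈ dfPairs a b c m := (mem_dfPairs_iff a b c m _).2 (Or.inr (Or.inl ⟨j, hj, Or.inl rfl⟩))
  have heB : s(b, c j) ∈ dfPairs a b c m := (mem_dfPairs_iff a b c m _).2 (Or.inr (Or.inl ⟨j, hj, Or.inr rfl⟩))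
  have hne : s(b, c j) ≠ s(a, c j) := (spokeA_ne_spokeB hab hca hj).symm
  -- the four pinned partition functions through the cut formula
  have hZ : ∀ σ τ : unitInterval, rcPartitionFunctionW (Function.update (Function.update w s(a, c j) σ) s(b, c j) τ) q ∅ =
      val q (conv (edgeAC (σ : ℝ)) (conv (edgeBC (τ : ℝ)) (conv (restVec q w a b c j (m - j)) (blockIn q w a b c j)))) := by
    intro σ τ
    have hsupp' : ∀ e, e ∉ dfPairs a b c m → Function.update (Function.update w s(a, c j) σ) s(b, c j) τ e = 0 := by
      intro e he
      have h1 : e ≠ s(b, c j) := fun h => he (h ▸ heB)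
      have h2 : e ≠ s(a, c j) := fun h => he (h ▸ heA)
      rw [Function.update_of_ne h1, Function.update_of_ne h2]; exact hsupp e he
    rw [rcPartitionFunctionW_eq_transferDF hab hinj hca hcb hcard q _ hsupp', cut_pin_spokes hab hinj hca hcb q w hj σ τ]
  set R := conv (restVec q w a b c j (m - j)) (blockIn q w a b c j) with hR
  have hRK : InKE q R := InKE.mul (inKE_restVec q w a b c (m - j) j) (inKE_blockIn q w a b c j)
  have hN : 0 ≤ masterN q (swapBC R) := (hRK.valid hq0.le hq1).nAB
  refine negCorr_of_pinned_rayleigh w hq0 hne ?_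
  rw [hZ 1 1, hZ 0 0, hZ 1 0, hZ 0 1]
  simp only [Set.Icc.coe_one, Set.Icc.coe_zero]
  have hid := rayleigh_AC_BC_eq q R
  have hq' : 0 ≤ 1 - q := sub_nonneg.2 hq1
  nlinarith [hid, hN, mul_nonneg (mul_nonneg (pow_nonneg hq0.le 2) hq') hN]

end Setting

end ThreeApex

end FK

end Summit.CriticalPhenomena.PercolationContinuityZ3.Theorems
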